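import Summits.NavierStokesRegularity.NavierStokesRegularity.Theorems.OddMorawetzLocal.Negative.OddMorawetzLocalRefutationDefs
import Summits.NavierStokesRegularity.NavierStokesRegularity.Theorems.OddMorawetzOddMorawetzLocalNormCast
import Summits.NavierStokesRegularity.NavierStokesRegularity.Theorems.OddMorawetzOddMorawetzLocalIdxCompleteSort
import HarnessLib

/-!
# Coefficient-level semantics of the jet algebra: `coeffOf` through `++`, `smul`, `norm`, `orbitSum`; the
specification of the kernel check `e1Check`

Crux `OddMorawetzLocal` (item stmt-NavierStokesRegularity-1376), refutation skeleton, stub `coeff_semantics`.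
Pure list algebra over Mathlib on the computable jet polynomials `JPoly R = List (R × List JVar)` of
`OddMorawetzLocalJetAlgebra` / `OddMorawetzLocalRefutationDefs`; no named facts, no new definitions.  Reuses the
landed `eq_of_monoCmp_eq` (`…NormCast`) and `sortVars_sortVars` (`…IdxCompleteSort`).

Step E1 of the refutation reads a jet polynomial as a coefficient vector on the monomial basis through
`JPoly.coeffOf p m` (the sum of the coefficients of the terms of `p` carrying exactly the monomial `m`) and needs:

* `coeffOf_append`, `coeffOf_smul`, `coeffOf_cons` — `coeffOf` is additive under concatenation, homogeneous under
  `JPoly.smul`, and peels off a head term;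
* idempotence of `sortVars` — the landed `sortVars_sortVars` (`sortVars` is an insertion sort);
* `coeffOf_norm` — on a polynomial whose monomials are already sorted, the normal form `JPoly.norm` (collect with
  `insertTerm`, whose merge branch only fires on EQUAL monomials: `eq_of_monoCmp_eq`; then drop zero coefficients)
  does not change any coefficient sum (`coeffOf_insertTerm`, `coeffOf_collect`);
* `coeffOf_orbitSum` — hence the collected orbit sum `orbitSum ν` has the same coefficients as the raw list of the
  48 signed images `permAct g ν` (whose monomials are `sortVars`-values, fixed by `sortVars`);
* `e1Check_spec` — unfolding the Boolean kernel pipeline `e1Check k reps lo n = true` into the per-monomial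
  identities: for every basis monomial `ν = idx k [lo + t]`, `t < n`, either `orbitSum ν = []` or
  `orbitSum ν = c • orbitSumN rep` for a LISTED representative `rep = reps[r] = (minImage ν).2` and an integer `c`.

They are assembled in `coeff_semantics` (the registered signature).
-/

noncomputable section

set_option linter.dupNamespace false
set_option autoImplicit false

namespace Summit.NavierStokesRegularity.NavierStokesRegularity.Theorems.OddMorawetz

namespace CoeffSemantics

variable {R : Type} [CommRing R]

/-! ### `coeffOf` on `[]` and on a cons -/

/-- The empty polynomial has all coefficients `0`. -/
theorem coeffOf_nil (m : List JVar) : JPoly.coeffOf ([] : JPoly R) m = 0 := by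
  simp [JPoly.coeffOf]

/-- Peeling off the head term: it contributes its coefficient iff it carries the monomial asked for. -/
theorem coeffOf_cons' (t : R × List JVar) (p : JPoly R) (m : List JVar) :
    JPoly.coeffOf (t :: p) m = (if t.2 = m then t.1 else 0) + JPoly.coeffOf p m := by
  unfold JPoly.coeffOf
  rw [List.filter_cons]
  by_cases h : t.2 = m
  · simp [h]
  · simp [h]

/-! ### `insertTerm` / `collect` at the level of coefficients -/

/-- Inserting a term adds its coefficient at its monomial and nothing elsewhere (the merge branch of
`JPoly.insertTerm` only merges equal monomials, `eq_of_monoCmp_eq`). -/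
theorem coeffOf_insertTerm (c : R) (m₀ m : List JVar) : ∀ q : JPoly R,
    JPoly.coeffOf (JPoly.insertTerm c m₀ q) m = (if m₀ = m then c else 0) + JPoly.coeffOf q m
  | [] => by simp [JPoly.insertTerm, coeffOf_cons', coeffOf_nil]
  | (c', m') :: rest => by
    cases hc : monoCmp m₀ m' with
    | lt => simp [JPoly.insertTerm, hc, coeffOf_cons']
    | eq =>
      obtain rfl := eq_of_monoCmp_eq m₀ m' hc
      simp only [JPoly.insertTerm, hc, coeffOf_cons']
      split_ifs <;> ring
    | gt =>
      simp only [JPoly.insertTerm, hc, coeffOf_cons', coeffOf_insertTerm c m₀ m rest]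
      ring

/-- Collecting a polynomial whose monomials are already sorted does not change any coefficient. -/
theorem coeffOf_collect (p : JPoly R) (hp : ∀ t ∈ p, sortVars t.2 = t.2) (m : List JVar) :
    JPoly.coeffOf (JPoly.collect p) m = JPoly.coeffOf p m := by
  induction p with
  | nil => rfl
  | cons t p ih =>
    show JPoly.coeffOf (JPoly.insertTerm t.1 (sortVars t.2) (JPoly.collect p)) m = _
    rw [coeffOf_insertTerm, hp t List.mem_cons_self, ih (fun s hs => hp s (List.mem_cons_of_mem _ hs)),
      coeffOf_cons']

end CoeffSemantics

open CoeffSemantics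

/-! ### The parts -/

/-- `coeffOf` is additive under concatenation (= `JPoly.add`). -/
theorem coeffOf_append {R : Type} [CommRing R] (p q : JPoly R) (m : List JVar) :
    JPoly.coeffOf (p ++ q) m = JPoly.coeffOf p m + JPoly.coeffOf q m := by
  unfold JPoly.coeffOf
  rw [List.filter_append, List.map_append, List.sum_append]

/-- `coeffOf` is homogeneous under scalar multiplication. -/
theorem coeffOf_smul {R : Type} [CommRing R] (c : R) (p : JPoly R) (m : List JVar) :
    JPoly.coeffOf (JPoly.smul c p) m = c * JPoly.coeffOf p m := by
  induction p with
  | nil => simp [JPoly.smul, coeffOf_nil]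
  | cons t p ih =>
    have h : JPoly.smul c (t :: p) = (c * t.1, t.2) :: JPoly.smul c p := rfl
    rw [h, coeffOf_cons', coeffOf_cons', ih, mul_add]
    by_cases ht : t.2 = m
    · simp [ht]
    · simp [ht]

/-- `coeffOf` of a cons: the head term contributes its coefficient iff it carries the monomial asked for. -/
theorem coeffOf_cons {R : Type} [CommRing R] (c : R) (m m' : List JVar) (p : JPoly R) :
    JPoly.coeffOf ((c, m) :: p) m' = (if m' = m then c else 0) + JPoly.coeffOf p m' := by
  rw [coeffOf_cons']
  by_cases h : m' = m
  · simp [h]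
  · simp [h, Ne.symm h]

/-- **The normal form preserves coefficients** of a polynomial whose monomials are already sorted: collecting only
reorders terms and merges equal monomials, and the final filter drops terms with coefficient `0`. -/
theorem coeffOf_norm {R : Type} [CommRing R] [DecidableEq R] (p : JPoly R) (hp : ∀ t ∈ p, sortVars t.2 = t.2)
    (m : List JVar) : JPoly.coeffOf (JPoly.norm p) m = JPoly.coeffOf p m := by
  rw [← coeffOf_collect p hp m]
  unfold JPoly.norm
  generalize JPoly.collect p = q
  induction q with
  | nil => rfl
  | cons t q ih =>
    rw [List.filter_cons]
    split_ifs with h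
    · rw [coeffOf_cons', coeffOf_cons', ih]
    · have h0 : t.1 = 0 := by simpa using h
      rw [coeffOf_cons', ih, h0]
      simp

/-- **The collected orbit sum has the coefficients of the raw list of signed images** (every raw monomial is a
`sortVars`-value, hence already sorted: `sortVars_sortVars`). -/
theorem coeffOf_orbitSum (ν m : List JVar) :
    JPoly.coeffOf (orbitSum ν) m =
      JPoly.coeffOf (b3List.map fun g => ((permAct g.1 g.2 ν).1, (permAct g.1 g.2 ν).2)) m := by
  unfold orbitSum
  refine coeffOf_norm _ (fun t ht => ?_) m
  obtain ⟨g, -, rfl⟩ := List.mem_map.1 ht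
  exact sortVars_sortVars _

/-- **Specification of the kernel check `e1Check`.**  If `e1Check k reps lo n = true` then for every `t < n` the
orbit sum of the basis monomial `ν = idx k [lo + t]` is either empty or an integer multiple of the normalised orbit
sum of a listed representative, namely the one equal to `(minImage ν).2`. -/
theorem e1Check_spec (k : ℕ) (reps : List (List JVar)) (lo n : ℕ) (h : e1Check k reps lo n = true) (t : ℕ)
    (ht : t < n) :
    orbitSum ((idx k).getD (lo + t) []) = [] ∨
      ∃ (r : ℕ) (c : ℤ), r < reps.length ∧ reps.getD r [] = (minImage ((idx k).getD (lo + t) [])).2 ∧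
        orbitSum ((idx k).getD (lo + t) []) = JPoly.smul c (orbitSumN (reps.getD r [])) := by
  unfold e1Check at h
  rw [List.all_eq_true] at h
  have h1 := h t (List.mem_range.2 ht)
  dsimp only at h1
  split at h1
  · rename_i hmem
    split at h1
    · exact absurd h1 Bool.false_ne_true
    · rename_i tm _
      have heq := of_decide_eq_true h1
      obtain ⟨r, hr, hrr⟩ := List.getElem_of_mem (List.mem_of_elem_eq_true hmem)
      refine Or.inr ⟨r, tm.1, hr, ?_, ?_⟩
      · rw [List.getD_eq_getElem reps [] hr]
        exact hrr
      · rw [List.getD_eq_getElem reps [] hr, hrr]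
        exact heq
  · exact Or.inl (List.isEmpty_iff.1 h1)

/-! ### The registered stub -/

/-- **Stub `coeff_semantics` of crux `OddMorawetzLocal` (refutation).**  Coefficient bookkeeping of the jet algebra
(`coeffOf` through `++`, `smul`, a head term), idempotence of `sortVars`, invariance of the coefficients under the
normal form (for sorted monomials) and hence for orbit sums, and the specification of the Boolean kernel check
`e1Check`: each checked basis monomial has orbit sum `0` or `c • orbitSumN rep` for a listed representative `rep`. -/
theorem coeff_semantics :
    (∀ {R : Type} [CommRing R] (p q : JPoly R) (m : List JVar),
      JPoly.coeffOf (p ++ q) m = JPoly.coeffOf p m + JPoly.coeffOf q m) ∧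
    (∀ {R : Type} [CommRing R] (c : R) (p : JPoly R) (m : List JVar),
      JPoly.coeffOf (JPoly.smul c p) m = c * JPoly.coeffOf p m) ∧
    (∀ {R : Type} [CommRing R] (c : R) (m m' : List JVar) (p : JPoly R),
      JPoly.coeffOf ((c, m) :: p) m' = (if m' = m then c else 0) + JPoly.coeffOf p m') ∧
    (∀ (m : List JVar), sortVars (sortVars m) = sortVars m) ∧
    (∀ {R : Type} [CommRing R] [DecidableEq R] (p : JPoly R), (∀ t ∈ p, sortVars t.2 = t.2) →
      ∀ m : List JVar, JPoly.coeffOf (JPoly.norm p) m = JPoly.coeffOf p m) ∧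
    (∀ (ν : List JVar) (m : List JVar), JPoly.coeffOf (orbitSum ν) m =
      JPoly.coeffOf (b3List.map fun g => ((permAct g.1 g.2 ν).1, (permAct g.1 g.2 ν).2)) m) ∧
    (∀ (k : ℕ) (reps : List (List JVar)) (lo n : ℕ), e1Check k reps lo n = true → ∀ t < n,
      orbitSum ((idx k).getD (lo + t) []) = [] ∨
        ∃ (r : ℕ) (c : ℤ), r < reps.length ∧ reps.getD r [] = (minImage ((idx k).getD (lo + t) [])).2 ∧
          orbitSum ((idx k).getD (lo + t) []) = JPoly.smul c (orbitSumN (reps.getD r []))) :=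
  ⟨coeffOf_append, coeffOf_smul, coeffOf_cons, sortVars_sortVars, coeffOf_norm, coeffOf_orbitSum, e1Check_spec⟩

end Summit.NavierStokesRegularity.NavierStokesRegularity.Theorems.OddMorawetz

end
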